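import Summits.ResolutionOfSingularities.ResolutionOfSingularities.Theorems.FrobeniusLadderFInjectiveMacaulayficationOfLocalDoorAdmFactOffClosed
import Literature.AlgebraicGeometry.Resolution.MacaulayficationBlowupForm
import HarnessLib

/-!
# DOOR v37 BY NAME: the crux ⟸ {CP 1.1, R–G 081R, CP 4.4, Česnavičius 2021 Thm. 5.3} ∧ (LR_adm) ∧ (LF_adm-F), with the Macaulayfication input
# consumed as the LITERATURE named fact (crux `FInjectiveMacaulayfication` stmt-ResolutionOfSingularities-15315, chain w45a; director-resolution DR-CZ3
# «ADMITTED» 2026-08-28T03:40:43Z; Literature `MacaulayficationBlowupForm.lean` p602953; seat res-L1-w45a-stub-2 g6)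

[OURS · L1 W4.5a] Support file (`--supports stmt-ResolutionOfSingularities-15315 --as helper`); NOT a statement of any manuscript; def-free; CONDITIONAL on
FOUR printed theorems BY NAME — `CossartPiltant2019General` (CP 2019 Thm. 1.1 (i)(ii)), `Stacks081R` (Raynaud–Gruson 5.2.2),
`CossartPiltant2019Principalization` (CP 2019 Prop. 4.4), and `CesnaviciusBlowupMacaulayfication` / `CesnaviciusBlowupMacaulayficationOffClosed`
(Česnavičius 2021 Thm. 5.3, blow-up form, vendored special case; `Literature/AlgebraicGeometry/Resolution/MacaulayficationBlowupForm.lean`) — and on the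
two CANDIDATE local statements of OURS (LR_adm) `RegularOffFiniteOfLRAdm.LocalResolutionNonClosedGe4Adm` and (LF_adm-F)
`LocalFullificationFibreAdmGe4Split.LocalFInjectivizationFibreAdmGe4`. AI-written (AI review is weaker than expert review).

* `cesnaviciusOffClosed_of_cesnavicius : CesnaviciusBlowupMacaulayfication → CesnaviciusBlowupMacaulayficationOffClosed` — (A) ⇒ (B), the 4-line
  implication kept out of the statement-only Literature file;
* `localMacaulayficationFibreAdmGe4_of_cesnavicius (hM : CesnaviciusBlowupMacaulayfication)` — the CM-half of the registered F-side stub DISCHARGED TO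
  PRINT BY NAME (the binder of `LocalFullificationFibreAdmGe4Split.localMacaulayficationFibreAdmGe4_of_fact` unfolds from the Literature def);
* **`fInjectiveMacaulayfication_of_localDoorAdm_of_cesnavicius (hG h081R hP) (hM : CesnaviciusBlowupMacaulayfication) (hLR_adm) (hF) : route decl`**
  and the (B)-named twin `…_of_cesnaviciusOffClosed` — door v37's `_proof` term with the fourth named fact BY NAME (one token for the registrar).
[folklore assembly; cite: Cesnavicius2021, Thm. 5.3] [cite: CossartPiltant2019, Thm. 1.1 (i)(ii); Prop. 4.4] [cite: RaynaudGruson1971, Thm. 5.2.2]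
[cite: Temkin2008, Prop. 2.3.4 (iii)]
-/

-- single-problem summit: the doubled namespace component is forced
set_option linter.dupNamespace false

noncomputable section

namespace Summit.ResolutionOfSingularities.ResolutionOfSingularities.Theorems.FInjectiveMacaulayfication.OfCesnaviciusFact

open CategoryTheory CategoryTheory.Limits AlgebraicGeometry TopologicalSpace IsLocalRing
open Literature.AlgebraicGeometry.Resolution
open Summit.ResolutionOfSingularities.ResolutionOfSingularities.Theorems.FInjectiveMacaulayfication
open SliceableCentre

/-- **(A) ⇒ (B)**: a Macaulayfying centre disjoint from the Cohen–Macaulay locus lies inside every closed `W` off which `X` is Cohen–Macaulay.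
[cite: Cesnavicius2021, Thm. 5.3] -/
theorem cesnaviciusOffClosed_of_cesnavicius (h : CesnaviciusBlowupMacaulayfication.{0}) :
    CesnaviciusBlowupMacaulayficationOffClosed.{0} := by
  intro X _ _ hX W _ hW
  obtain ⟨Z, hZ, hbl⟩ := h X hX
  refine ⟨Z, fun x hx => ?_, hbl⟩
  by_contra hxW
  exact hZ x hx (hW x hxW)

/-- **The CM-half of the registered F-side stub (LF_adm), DISCHARGED TO PRINT BY NAME** (Česnavičius 2021 Thm. 5.3 as the Literature named fact).
[OURS · conditional-result] [cite: Cesnavicius2021, Thm. 5.3] -/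
theorem localMacaulayficationFibreAdmGe4_of_cesnavicius (hM : CesnaviciusBlowupMacaulayfication.{0}) :
    LocalFullificationFibreAdmGe4Split.LocalMacaulayficationFibreAdmGe4 :=
  LocalFullificationFibreAdmGe4Split.localMacaulayficationFibreAdmGe4_of_fact hM

/-- The same from the weaker named form (B). [OURS · conditional-result] [cite: Cesnavicius2021, Thm. 5.3] -/
theorem localMacaulayficationFibreAdmGe4_of_cesnaviciusOffClosed (hM : CesnaviciusBlowupMacaulayficationOffClosed.{0}) :
    LocalFullificationFibreAdmGe4Split.LocalMacaulayficationFibreAdmGe4 :=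
  LocalMacaulayficationOfFactOffClosed.localMacaulayficationFibreAdmGe4_of_factOffClosed hM

/-- **★ DOOR v37's `_proof` TERM BY NAME: the route decl `Theses.FrobeniusLadder.FInjectiveMacaulayfication` from {CP 2019 Thm. 1.1, Raynaud–Gruson 5.2.2,
CP 2019 Prop. 4.4, Česnavičius 2021 Thm. 5.3} (four printed theorems BY NAME) ∧ (LR_adm) ∧ (LF_adm-F).** [OURS · conditional-result]
[cite: Cesnavicius2021, Thm. 5.3] [cite: CossartPiltant2019, Thm. 1.1 (i)(ii); Prop. 4.4] [cite: Temkin2008, Prop. 2.3.4 (iii)] -/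
theorem fInjectiveMacaulayfication_of_localDoorAdm_of_cesnavicius
    (hG : CossartPiltant2019General.{0}) (h081R : Stacks081R.{0}) (hP : CossartPiltant2019Principalization.{0})
    (hM : CesnaviciusBlowupMacaulayfication.{0})
    (hLR : RegularOffFiniteOfLRAdm.LocalResolutionNonClosedGe4Adm)
    (hF : LocalFullificationFibreAdmGe4Split.LocalFInjectivizationFibreAdmGe4) :
    Summit.ResolutionOfSingularities.ResolutionOfSingularities.Theses.FrobeniusLadder.FInjectiveMacaulayfication :=
  OfLocalDoorAdm.fInjectiveMacaulayfication_of_localDoorAdm_of_fact hG h081R hP hM hLR hF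

/-- The same with the weaker named form (B). [OURS · conditional-result] [cite: Cesnavicius2021, Thm. 5.3] -/
theorem fInjectiveMacaulayfication_of_localDoorAdm_of_cesnaviciusOffClosed
    (hG : CossartPiltant2019General.{0}) (h081R : Stacks081R.{0}) (hP : CossartPiltant2019Principalization.{0})
    (hM : CesnaviciusBlowupMacaulayficationOffClosed.{0})
    (hLR : RegularOffFiniteOfLRAdm.LocalResolutionNonClosedGe4Adm)
    (hF : LocalFullificationFibreAdmGe4Split.LocalFInjectivizationFibreAdmGe4) :
    Summit.ResolutionOfSingularities.ResolutionOfSingularities.Theses.FrobeniusLadder.FInjectiveMacaulayfication :=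
  OfLocalDoorAdmFactOffClosed.fInjectiveMacaulayfication_of_localDoorAdm_of_factOffClosed hG h081R hP hM hLR hF

end Summit.ResolutionOfSingularities.ResolutionOfSingularities.Theorems.FInjectiveMacaulayfication.OfCesnaviciusFact

end
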